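import Summits.CriticalPhenomena.PercolationContinuityZ3.Theorems.PercNonProliferationSubpolynomialBlockingStubCruxIffWallPatch
import Summits.CriticalPhenomena.PercolationContinuityZ3.Theorems.SubpolynomialBlocking.Negative.Strengthenings
import Literature.Probability.Percolation.BondPercolationSymmetry
import Literature.Probability.Percolation.SiteConnectionTools
import Literature.Probability.Percolation.HalfSpaceBrickSymmetry
import Literature.Probability.Percolation.HalfSpace

/-!
# Line `root-trick-wall-patch` for the crux `SubpolynomialBlocking` (stmt-CriticalPhenomena-4446) — lead's skeleton

STATUS (lead c6, prover-line-stmt-CriticalPhenomena-4446-c6-0, 2026-08-16T20:15Z): re-owned from c3 UNCHANGED in content;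
`SubpolynomialBlocking_of` now takes only the open stub 3 as hypothesis (stubs 1, 2 discharged by import), so the
registered stub list is exactly {stub_wallPatchEnclosure}. New this seat (helper files `--supports 4446`, see the crux
NOTES.md): the uniqueness ↔ blocking axis at p_c — same-p crossing+gluing criterion, dichotomy ε₀ ≤ u_L + P(NonUnique_L),
blocking ⇒ non-uniqueness transfer, unconditional non-uniqueness floor.

STATUS (lead c3, prover-line-stmt-CriticalPhenomena-4446-c3-0, 2026-08-16): stubs 1, 2, 4 are LANDED
(`stub_shieldCover` p97113, `stub_harrisShields` p96555, `stub_enclosureOfBlocking` p98377 — seat -1) and are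
discharged below by import; the line's certificate `crux ⟺ C⁺` is LANDED as a Theorems file
(`stub_cruxIffWallPatch`, `subpolynomialBlocking_of_wallPatchEnclosure`, `wallPatchEnclosure_floor` —
Theorems/PercNonProliferationSubpolynomialBlockingStubCruxIffWallPatch.lean, p115776). The ONLY `sorry` left is
STUB 3 `stub_wallPatchEnclosure` (`C⁺`), which is the crux itself relocated to the wall (open 3-D RSW lower
bound). Further LANDED helper files of this lead (`--supports 4446`, namespace `…Theorems.SubpolynomialBlocking`):
`stub_cruxIffExponentZero` (p116300: crux ⟺ log(1/u_n)/log n → 0), `stub_blockProbRatio_mono` (p116315),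
`stub_enclosureOfBlockingRatio` (p116465), `stub_enclosureOfBlockingSubpatch` (p118150) and `stub_cruxIffRatioAll` (p118340:
∀ R ≥ 2, crux ⟺ ratio-`R` sub-polynomial blocking — aspect ratio is immaterial, Disproof §7b answered);
negative lane `stub_annulusCrossing_renorm` (p117117) + `stub_critAnnulusCrossing_pos` (p116959) + `critAnnulusCrossing_pos`,
`blockProb_le_one_sub`, `real_siteToBoundary_ge` (p118164: critical annulus crossing ≥ c in every d ≥ 2, so u_n ≤ 1 - c; one-arm
≥ c/(2n+1)^d); calibration `stub_blockProb_two_pos`, `subpolynomialBlockingAt_two` (p117040: the crux's statement is TRUE on ℤ²).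

RESHAPED by seat -1 (2026-08-16) from the planner's checked skeleton
`Cruxes/SubpolynomialBlocking/Lines/root-trick-wall-patch.lean` (same composition idea: ROOT TRICK + HARRIS
reduce a blocking probability to a fixed power of the WALL-PATCH ENCLOSURE probability `h r`, and the crux follows
from the transfer target `C⁺ = WallPatchEnclosureSubpoly`). What changed and why:

* The planner hung `K = 6144` signed-permutation copies of the half-space ball directly on the six faces of
  `∂ⁱⁿΛ_{2n}` so as not to depend on the then-unlanded cross-sandwich front end. That front end is now LANDED
  (`stub_sixSlab` p82361, `stub_tiling` p80188, `stub_upperSeedSandwich` p84567, and the certified equivalence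
  `stub_cruxIffSeedSubpoly` p86229: crux ⟺ `SeedSubpoly k` for every `k ≥ 2`). So this skeleton returns to the
  idea card's ORIGINAL picture (Ideas/root-trick-wall-patch.md, "100 wall cells"): the root trick is run on the
  landed SEED BOX `[0,n] × [0, n+⌊n/2⌋]²` (`k = 2`), with `100` TRANSLATED copies of the standard half-space ball
  standing on its bottom face `{x₀ = 0}` (depth pointing up). Translations only: no signed permutations, no face
  bookkeeping. Composition: `C⁺ ⇒ seed₂ sub-polynomial ⇒ crux` (`stub_cruxIffSeedSubpoly 2`).
* NEW registered stub `stub_enclosureOfBlocking` (necessity, provable now): `u_{⌈r/2⌉} ≤ h r` (a first-exit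
  argument: the annulus `Λ_{2m}(v) ∖ Λ_m(v)`, `m = ⌈r/2⌉`, centred on the patch sits inside the half-space ball and
  separates the patch from the far face). With it `crux ⇒ C⁺` is two lines (`wallPatch_of_crux`), so the line's
  claim "C⁺ is EQUIVALENT to the crux" becomes kernel-checked (`crux_iff_wallPatch`), and a kill of `C⁺` is a
  certified kill of the crux.
* The four registered `theorem stub_*` are stated in TREE VOCABULARY ONLY (fully expanded: `openCrossing`,
  `Set.Icc`, `zdShiftIso`, `Negative.blockProb`), so that helper files under `Theorems/` prove them verbatim; the
  local names (`patch`, `hsBall`, `farFace`, `hsEvt`, `h`, `seedSeal`, `cellShield`, the `Prop`s `ShieldCover` …) are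
  `abbrev`s and the application `SubpolynomialBlocking_of stub_shieldCover …` type-checks by unfolding.

THE OBJECTS (all probabilities at `p_c(ℤ³)`, `μc`):
* `patch r = {0} × [0,r)²` (wall patch), `hsBall r = [0,4r] × [-4r, 5r-1]²` (= `H ∩ B⁺(patch, 4r)`),
  `farFace r` = its points at sup-distance exactly `4r` from the patch (depth `4r` or a lateral extreme),
  `hsEvt r = (openCrossing (hsBall r) (patch r) (farFace r))ᶜ`, `h r = μc.real (hsEvt r)`,
  `C⁺ = WallPatchEnclosureSubpoly : ∀ s > 0, ∀ᶠ r, r^{-s} ≤ h r` — SAME point sets and SAME event as the planner's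
  skeleton (there `hsBall` was written with a hand-rolled `cbox`; here with `Set.Icc`, the tree's vocabulary).
* `seedBox n = Set.Icc 0 ![n, n+⌊n/2⌋, n+⌊n/2⌋]`, `seedSeal n` = "no open path inside `seedBox n` from `{x₀ = 0}` to
  `{x₀ = n}`" — VERBATIM the `k = 2` instance of the set in the landed `stub_cruxIffSeedSubpoly` (`seed_eq : … = … := rfl`).
* cells `c : Fin 10 × Fin 10` at patch scale `r`: `cellVec r c = (0, c₁ r, c₂ r)`,
  `cellShield r c = (openCrossing (τ '' hsBall r) (τ '' patch r) (τ '' farFace r))ᶜ`, `τ = zdShiftIso (cellVec r c)`;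
  at seed scale `n` the patch scale is `cellScale n = ⌊n/5⌋`.

THE STUBS (registered; `SubpolynomialBlocking_of` concludes the crux decl BY NAME from the first three):
1. `stub_shieldCover` (M, provable now, deterministic): `1 ≤ r`, `4r < n`, `n + ⌊n/2⌋ < 10r`, `ω ⊆ E(ℤ³)`,
   all 100 cells shielded ⇒ `seedSeal n`.
2. `stub_harrisShields` (S, provable now): `h r ^ 100 ≤ μc.real (⋂ c, cellShield r c)` (shift invariance + Harris).
3. `stub_wallPatchEnclosure` (XL, OPEN, the lead's): `C⁺`.
4. `stub_enclosureOfBlocking` (S/M, provable now, necessity): `∀ r ≥ 1, blockProb 3 p_c ⌈r/2⌉ ≤ h r`.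

DISPROOF USED (`Cruxes/SubpolynomialBlocking/Disproof.lean`, cdisprove cycle 1 FINAL; Negative lane imported through
`StubCruxIffSeedSubpoly`/`Strengthenings`): §2/§4 (a proof must use `p ≤ p_c` and `d ≤ 6`) are honoured at STUB 3 only —
stubs 1, 2, 4 hold at every `p` and in every `d`, so by `crux_iff_wallPatch` `C⁺` is false above `p_c` and in `d ≥ 7`
(`η = 0`) exactly like the crux; §6 strengthenings avoided (`C⁺` keeps `∀ s > 0, ∀ᶠ r`); §7b: ratio 2 throughout;
§8 Targets: none posted for this line yet.
-/

noncomputable section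

namespace Summit.CriticalPhenomena.PercolationContinuityZ3.Cruxes.SubpolynomialBlocking.RootTrickWallPatch

open MeasureTheory Filter Topology
open Literature.Probability.Percolation Literature.Probability.LatticeModels
open Summit.CriticalPhenomena.PercolationContinuityZ3.Theorems.SubpolynomialBlocking

/-! ## Objects of the line (local `abbrev`s; the registered stubs below are their unfoldings) -/

/-- The critical bond percolation measure on `ℤ³`. -/
abbrev μc : Measure (BondConfig (Site 3)) := bondPercolation (zdGraph 3) (criticalProbI 3)

/-- The wall patch `P_r = {0} × [0,r)²` on the wall `{x₀ = 0}` of the half-space `H = {0 ≤ x₀}`. -/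
abbrev patch (r : ℕ) : Set (Site 3) := {x : Site 3 | x 0 = 0 ∧ 0 ≤ x 1 ∧ x 1 < (r : ℤ) ∧ 0 ≤ x 2 ∧ x 2 < (r : ℤ)}

/-- `H ∩ B⁺(P_r, 4r) = [0,4r] × [-4r, 5r-1]²`: the points of the half-space at sup-distance `≤ 4r` from the patch,
as an order interval of `Site 3 = Fin 3 → ℤ`. -/
abbrev hsBall (r : ℕ) : Set (Site 3) :=
  Set.Icc (![0, -(4 * (r : ℤ)), -(4 * (r : ℤ))] : Site 3) ![4 * (r : ℤ), 5 * (r : ℤ) - 1, 5 * (r : ℤ) - 1]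

/-- The far boundary `H ∩ S(P_r, 4r)`: points of `hsBall r` at sup-distance exactly `4r` from the patch
(depth `4r`, or lateral offset `4r`). -/
abbrev farFace (r : ℕ) : Set (Site 3) :=
  {y : Site 3 | y ∈ Set.Icc (![0, -(4 * (r : ℤ)), -(4 * (r : ℤ))] : Site 3) ![4 * (r : ℤ), 5 * (r : ℤ) - 1, 5 * (r : ℤ) - 1] ∧
    (y 0 = 4 * (r : ℤ) ∨ y 1 = -(4 * (r : ℤ)) ∨ y 1 = 5 * (r : ℤ) - 1 ∨ y 2 = -(4 * (r : ℤ)) ∨ y 2 = 5 * (r : ℤ) - 1)}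

/-- HALF-SPACE PATCH ENCLOSURE `HS(r) = HS(r,4r)`: no open path inside `H ∩ B⁺(P_r, 4r)` joins the wall patch
`P_r` to sup-distance `4r`. Decreasing event (complement of an open crossing event). -/
abbrev hsEvt (r : ℕ) : Set (BondConfig (Site 3)) := (openCrossing (hsBall r) (patch r) (farFace r))ᶜ

/-- `h r := P_{p_c}(HS(r))`, the critical wall-patch enclosure probability. -/
abbrev h (r : ℕ) : ℝ := μc.real (hsEvt r)

/-- The TRANSFER TARGET `C⁺` (mesoscopic Barsky–Grimmett–Newman): the critical wall-patch enclosure probability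
decays slower than any power of the patch side. -/
abbrev WallPatchEnclosureSubpoly : Prop := ∀ s : ℝ, 0 < s → ∀ᶠ r : ℕ in atTop, (r : ℝ) ^ (-s) ≤ h r

/-- The landed seed box of aspect ratio `3/2`: `[0,n] × [0, n+⌊n/2⌋]²` (the `k = 2` box of `stub_cruxIffSeedSubpoly`). -/
abbrev seedBox (n : ℕ) : Set (Site 3) :=
  Set.Icc (0 : Site 3) ![(n : ℤ), (n : ℤ) + (n / 2 : ℕ), (n : ℤ) + (n / 2 : ℕ)]

/-- The seed box is SEALED across direction `0`: no open path inside it from the face `{x₀ = 0}` to the face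
`{x₀ = n}` (verbatim the `k = 2` event of `stub_cruxIffSeedSubpoly`). -/
abbrev seedSeal (n : ℕ) : Set (BondConfig (Site 3)) :=
  (openCrossing (seedBox n) {x | x ∈ seedBox n ∧ x 0 = 0} {y | y ∈ seedBox n ∧ y 0 = (n : ℤ)})ᶜ

/-- `seed n := P_{p_c}(seedSeal n)`. -/
abbrev seed (n : ℕ) : ℝ := μc.real (seedSeal n)

/-! ### Cells: translated copies of the half-space ball standing on the bottom face of the seed box -/

/-- Cell index: lateral offsets `(c₁, c₂)`; the patch of cell `c` is `{0} × [c₁ r, (c₁+1) r) × [c₂ r, (c₂+1) r)`.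
When `10 r > n + ⌊n/2⌋`, the `10 × 10` patches cover the bottom face of `seedBox n`. -/
abbrev Cell : Type := Fin 10 × Fin 10

/-- The patch scale used at seed scale `n`: `r(n) = ⌊n/5⌋`, so that `4 r(n) < n` (the top face lies outside every
cell's half-space ball), `r(n) ≥ 4` and `n + ⌊n/2⌋ < 10 r(n)` for `n ≥ 20`. -/
def cellScale (n : ℕ) : ℕ := n / 5

/-- Translation vector of cell `c` at patch scale `r`: `(0, c₁ r, c₂ r)`. -/
abbrev cellVec (r : ℕ) (c : Cell) : Site 3 := ![0, ((c.1 : ℕ) : ℤ) * (r : ℤ), ((c.2 : ℕ) : ℤ) * (r : ℤ)]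

/-- The shield event of cell `c` at patch scale `r`: no open path inside the translated half-space ball from the
translated patch to the translated far face. It is the preimage of `hsEvt r` under the shift of configurations,
hence has probability `h r` (`StubSixSlab.real_compl_openCrossing_image`). -/
abbrev cellShield (r : ℕ) (c : Cell) : Set (BondConfig (Site 3)) :=
  (openCrossing ((zdShiftIso (cellVec r c)) '' hsBall r) ((zdShiftIso (cellVec r c)) '' patch r)
      ((zdShiftIso (cellVec r c)) '' farFace r))ᶜ

/-! ## The four stub statements (local `Prop`s) -/

/-- STUB 1 statement (ROOT TRICK = covering + first exit; deterministic, lattice configurations): if every cell of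
the bottom face of the seed box is shielded then the seed box is sealed. -/
abbrev ShieldCover : Prop :=
  ∀ n r : ℕ, 1 ≤ r → 4 * r < n → n + n / 2 < 10 * r → ∀ ω : BondConfig (Site 3), ω ⊆ (zdGraph 3).edgeSet →
    (∀ c : Cell, ω ∈ cellShield r c) → ω ∈ seedSeal n

/-- STUB 2 statement (Harris–FKG for the `100` decreasing shield events + shift invariance `P(cellShield r c) = h r`). -/
abbrev HarrisShields : Prop :=
  ∀ r : ℕ, h r ^ 100 ≤ μc.real (⋂ c : Cell, cellShield r c)

/-- STUB 4 statement (NECESSITY: the enclosure contains a translate of the crux's blocking event at scale `⌈r/2⌉`). -/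
abbrev EnclosureOfBlocking : Prop :=
  ∀ r : ℕ, 1 ≤ r → Negative.blockProb 3 (criticalProbI 3) ((r + 1) / 2) ≤ h r

/-! ## Registered stubs — EXPANDED, tree vocabulary only (helper files prove these signatures verbatim) -/

/-- **STUB 1 `shieldCover`** (M, PROVABLE NOW; deterministic). Read with `r` the patch scale and the `100` cells
`c : Fin 10 × Fin 10` shifted by `v_c = (0, c₁ r, c₂ r)` (`zdShiftIso_apply : τ z = z + v_c`). Let `ω ⊆ E(ℤ³)` and
suppose `ω ∈ openCrossing (seedBox n) {x₀ = 0} {x₀ = n}`: an open lattice walk `γ` inside the seed box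
(`exists_walk_of_mem_openConnIn`) from `x` (`x₀ = 0`, `0 ≤ x₁, x₂ ≤ n + ⌊n/2⌋`) to `y` (`y₀ = n`).
(a) COVERING: `c := (⌊x₁/r⌋, ⌊x₂/r⌋)` has both entries `≤ 9` (`n + ⌊n/2⌋ < 10 r`) and `x - v_c ∈ patch r`, i.e.
`x ∈ τ '' patch r ⊆ τ '' hsBall r`. (b) FIRST EXIT: `y₀ = n > 4r`, so `y ∉ τ '' hsBall r`; let `z` be the last vertex
of the maximal initial segment of `γ` inside `τ '' hsBall r` and `z'` its successor (`z' ∉ τ '' hsBall r`, `z ∼ z'` a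
unit step by `zdGraph_adj_iff`, `z'` in the seed box so `z'₀ ≥ 0`): the violated constraint is `z'₀ > 4r` or a
lateral one, whence `z₀ = 4r ∨ z₁ - c₁r ∈ {-4r, 5r-1} ∨ z₂ - c₂r ∈ {-4r, 5r-1}`, i.e. `z ∈ τ '' farFace r`.
(c) The initial segment is a walk inside `τ '' hsBall r` with open edges, so `ω ∈ openConnIn (τ '' hsBall r) x z`
(`mem_openConnIn_of_walk`) and `ω ∈ openCrossing (cell c)`: contradiction with the shield hypothesis.
Walk tools: induction on `SimpleGraph.Walk` for the first exit (pattern of `StubSixSlab.exists_edge_not_mem` /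
`Negative.not_mem_annulusCrossing_of_forall_notMem`; Mathlib `SimpleGraph.Walk.takeUntil` / `exists_boundary_dart`).
[card First lemma (R1); line card stub 1] -/
theorem stub_shieldCover :
    ∀ n r : ℕ, 1 ≤ r → 4 * r < n → n + n / 2 < 10 * r →
      ∀ ω : BondConfig (Site 3), ω ⊆ (zdGraph 3).edgeSet →
        (∀ c : Fin 10 × Fin 10, ω ∈ (openCrossing
            ((zdShiftIso (![0, ((c.1 : ℕ) : ℤ) * (r : ℤ), ((c.2 : ℕ) : ℤ) * (r : ℤ)] : Site 3)) ''
              Set.Icc (![0, -(4 * (r : ℤ)), -(4 * (r : ℤ))] : Site 3) ![4 * (r : ℤ), 5 * (r : ℤ) - 1, 5 * (r : ℤ) - 1])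
            ((zdShiftIso (![0, ((c.1 : ℕ) : ℤ) * (r : ℤ), ((c.2 : ℕ) : ℤ) * (r : ℤ)] : Site 3)) ''
              {x : Site 3 | x 0 = 0 ∧ 0 ≤ x 1 ∧ x 1 < (r : ℤ) ∧ 0 ≤ x 2 ∧ x 2 < (r : ℤ)})
            ((zdShiftIso (![0, ((c.1 : ℕ) : ℤ) * (r : ℤ), ((c.2 : ℕ) : ℤ) * (r : ℤ)] : Site 3)) ''
              {y : Site 3 | y ∈ Set.Icc (![0, -(4 * (r : ℤ)), -(4 * (r : ℤ))] : Site 3)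
                  ![4 * (r : ℤ), 5 * (r : ℤ) - 1, 5 * (r : ℤ) - 1] ∧
                (y 0 = 4 * (r : ℤ) ∨ y 1 = -(4 * (r : ℤ)) ∨ y 1 = 5 * (r : ℤ) - 1 ∨
                  y 2 = -(4 * (r : ℤ)) ∨ y 2 = 5 * (r : ℤ) - 1)}))ᶜ) →
        ω ∈ (openCrossing (Set.Icc (0 : Site 3) ![(n : ℤ), (n : ℤ) + (n / 2 : ℕ), (n : ℤ) + (n / 2 : ℕ)])
            {x | x ∈ Set.Icc (0 : Site 3) ![(n : ℤ), (n : ℤ) + (n / 2 : ℕ), (n : ℤ) + (n / 2 : ℕ)] ∧ x 0 = 0}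
            {y | y ∈ Set.Icc (0 : Site 3) ![(n : ℤ), (n : ℤ) + (n / 2 : ℕ), (n : ℤ) + (n / 2 : ℕ)] ∧
              y 0 = (n : ℤ)})ᶜ :=
  _root_.Summit.CriticalPhenomena.PercolationContinuityZ3.Theorems.SubpolynomialBlocking.stub_shieldCover

/-- **STUB 2 `harrisShields`** (S, PROVABLE NOW). (i) SYMMETRY: each cell event is literally
`(openCrossing (τ '' S) (τ '' A) (τ '' B))ᶜ` for the graph automorphism `τ = zdShiftIso v_c`, so its probability is
that of `(openCrossing S A B)ᶜ` by `StubSixSlab.real_compl_openCrossing_image τ p S A B`. (ii) Each cell event is a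
lower set (`(isUpperSet_openCrossing _ _ _).compl`) and measurable (`(measurableSet_openCrossing_of_countable _ _ _).compl`).
(iii) HARRIS–FKG for finitely many decreasing events of equal probability:
`prob_pow_le_biInter_of_isLowerSet (zdGraph 3) p Finset.univ D …` gives `c ^ univ.card ≤ μ.real (⋂ i ∈ univ, D i)`;
rewrite `⋂ i ∈ Finset.univ, D i = ⋂ i, D i` (`Set.iInter_congr`/`Set.iInter_true`-type simp with `Finset.mem_univ`)
and `Finset.card_univ = 100` (`Fintype.card_prod`, `Fintype.card_fin`). Cf. `StubSixSlab.pow_six_le`.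
[card: Harris step of (R1); Grimmett 1999 Thm 2.4] -/
theorem stub_harrisShields :
    ∀ r : ℕ,
      (bondPercolation (zdGraph 3) (criticalProbI 3)).real
          (openCrossing
            (Set.Icc (![0, -(4 * (r : ℤ)), -(4 * (r : ℤ))] : Site 3) ![4 * (r : ℤ), 5 * (r : ℤ) - 1, 5 * (r : ℤ) - 1])
            {x : Site 3 | x 0 = 0 ∧ 0 ≤ x 1 ∧ x 1 < (r : ℤ) ∧ 0 ≤ x 2 ∧ x 2 < (r : ℤ)}
            {y : Site 3 | y ∈ Set.Icc (![0, -(4 * (r : ℤ)), -(4 * (r : ℤ))] : Site 3)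
                ![4 * (r : ℤ), 5 * (r : ℤ) - 1, 5 * (r : ℤ) - 1] ∧
              (y 0 = 4 * (r : ℤ) ∨ y 1 = -(4 * (r : ℤ)) ∨ y 1 = 5 * (r : ℤ) - 1 ∨
                y 2 = -(4 * (r : ℤ)) ∨ y 2 = 5 * (r : ℤ) - 1)})ᶜ ^ 100 ≤
        (bondPercolation (zdGraph 3) (criticalProbI 3)).real
          (⋂ c : Fin 10 × Fin 10, (openCrossing
            ((zdShiftIso (![0, ((c.1 : ℕ) : ℤ) * (r : ℤ), ((c.2 : ℕ) : ℤ) * (r : ℤ)] : Site 3)) ''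
              Set.Icc (![0, -(4 * (r : ℤ)), -(4 * (r : ℤ))] : Site 3) ![4 * (r : ℤ), 5 * (r : ℤ) - 1, 5 * (r : ℤ) - 1])
            ((zdShiftIso (![0, ((c.1 : ℕ) : ℤ) * (r : ℤ), ((c.2 : ℕ) : ℤ) * (r : ℤ)] : Site 3)) ''
              {x : Site 3 | x 0 = 0 ∧ 0 ≤ x 1 ∧ x 1 < (r : ℤ) ∧ 0 ≤ x 2 ∧ x 2 < (r : ℤ)})
            ((zdShiftIso (![0, ((c.1 : ℕ) : ℤ) * (r : ℤ), ((c.2 : ℕ) : ℤ) * (r : ℤ)] : Site 3)) ''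
              {y : Site 3 | y ∈ Set.Icc (![0, -(4 * (r : ℤ)), -(4 * (r : ℤ))] : Site 3)
                  ![4 * (r : ℤ), 5 * (r : ℤ) - 1, 5 * (r : ℤ) - 1] ∧
                (y 0 = 4 * (r : ℤ) ∨ y 1 = -(4 * (r : ℤ)) ∨ y 1 = 5 * (r : ℤ) - 1 ∨
                  y 2 = -(4 * (r : ℤ)) ∨ y 2 = 5 * (r : ℤ) - 1)}))ᶜ) :=
  _root_.Summit.CriticalPhenomena.PercolationContinuityZ3.Theorems.SubpolynomialBlocking.stub_harrisShields

/-- **STUB 3 `wallPatchEnclosure`** (XL, OPEN — THE LOAD-BEARING STUB, the lead's): the transfer target `C⁺`,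
`∀ s > 0, ∀ᶠ r, r^{-s} ≤ h r` — "a wall patch of side `r` is walled off inside the half-space within distance `4r` with
probability `≥ r^{-o(1)}`", Barsky–Grimmett–Newman made uniform at aspect ratio `4`. EQUIVALENT to the crux
(`crux_iff_wallPatch` below, modulo stubs 1, 2, 4). Numerically `h(r)` is FLAT: `0.696, 0.695, 0.672, 0.684, 0.681,
0.685, 0.689` for `r = 2, 3, 4, 6, 8, 11, 16` (kit j010925, s.e. ≤ 0.013), with `E[#escaping patch points] ≈ r^{1.03}`
(`= r^{2-x_s}`, `x_s ≈ 0.975`) and wall one-arm to `4r` of log-slope `≈ -1.0`. WHY IT MIGHT FAIL / WHAT A PROOF MUST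
USE: false for every `p > p_c` and in `d ≥ 7` under `η = 0` (Disproof §2/§4 transported by `crux_iff_wallPatch`), so the
proof must use `p ≤ p_c(ℤ³)` and a `d ≤ 6` input; the card's engines do not supply it (E1 forces slab thickness
`εr`, `ε ≲ 1/log r`, and then "no dive" is super-polynomially rare; E2 is of `X_B` strength from two open inputs);
BGN's same-`p` half-space criterion + openness at `p_c` regrows SEEDS and gives nothing for patch sources beyond the
fixed-seed constant (line card, Hardest stub (2)). -/
theorem stub_wallPatchEnclosure :
    ∀ s : ℝ, 0 < s → ∀ᶠ r : ℕ in atTop, (r : ℝ) ^ (-s) ≤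
      (bondPercolation (zdGraph 3) (criticalProbI 3)).real
          (openCrossing
            (Set.Icc (![0, -(4 * (r : ℤ)), -(4 * (r : ℤ))] : Site 3) ![4 * (r : ℤ), 5 * (r : ℤ) - 1, 5 * (r : ℤ) - 1])
            {x : Site 3 | x 0 = 0 ∧ 0 ≤ x 1 ∧ x 1 < (r : ℤ) ∧ 0 ≤ x 2 ∧ x 2 < (r : ℤ)}
            {y : Site 3 | y ∈ Set.Icc (![0, -(4 * (r : ℤ)), -(4 * (r : ℤ))] : Site 3)
                ![4 * (r : ℤ), 5 * (r : ℤ) - 1, 5 * (r : ℤ) - 1] ∧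
              (y 0 = 4 * (r : ℤ) ∨ y 1 = -(4 * (r : ℤ)) ∨ y 1 = 5 * (r : ℤ) - 1 ∨
                y 2 = -(4 * (r : ℤ)) ∨ y 2 = 5 * (r : ℤ) - 1)})ᶜ := by
  sorry

/-- **STUB 4 `enclosureOfBlocking`** (S/M, PROVABLE NOW — necessity). For `r ≥ 1` put `m := ⌈r/2⌉ = (r+1)/2` and
`v := (0, ⌊r/2⌋, ⌊r/2⌋)`. Then (i) `patch r ⊆ v + Λ_m` (coordinate `0`: `0 ∈ [-m,m]`; laterally
`[0, r-1] ⊆ [⌊r/2⌋ - m, ⌊r/2⌋ + m]`), (ii) `farFace r ∩ (v + Λ_{2m}) = ∅` (`2m ≤ r+1 < 4r`; `⌊r/2⌋ - 2m > -4r`;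
`⌊r/2⌋ + 2m ≤ 3r/2 + 1 < 5r - 1`). If `ω ⊆ E(ℤ³)` lies in the SHIFTED blocking event
`(openCrossing (τ '' ↑(box 3 (2m))) (τ '' ↑(box 3 m)) (τ '' ↑(innerBoundary (zdGraph 3) (box 3 (2m)))))ᶜ`, `τ = zdShiftIso v`,
then `ω` lies in the enclosure event: an open lattice walk inside `hsBall r` from `x ∈ patch r` to `y ∈ farFace r` starts
in `τ '' Λ_m` and ends outside `τ '' Λ_{2m}`; its maximal initial segment inside `τ '' Λ_{2m}` ends at a vertex `z` with a
lattice neighbour outside, i.e. `z - v ∈ innerBoundary (zdGraph 3) (box 3 (2m))` (`mem_innerBoundary_iff`,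
`zdGraph_adj_shift_iff`), and is an open walk inside `τ '' Λ_{2m}` (`mem_openConnIn_of_walk`) — a shifted annulus
crossing, contradiction. Measure: `real_mono_of_forall_subset_edgeSet`, and the shifted blocking event has probability
`blockProb 3 p_c m = μc.real (annulusCrossing 3 m)ᶜ` by `StubSixSlab.real_compl_openCrossing_image (zdShiftIso v)`
(`annulusCrossing 3 m = openCrossing ↑(box 3 (2m)) ↑(box 3 m) ↑(innerBoundary …)` by `Set.ext`/`rfl`).
[seat -0 PICKED.md: "`hsEvt r ⊇ shift(blockEvt ⌈r/2⌉)` gives `h(r) ≥ u_{⌈r/2⌉}` in one line"] -/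
theorem stub_enclosureOfBlocking :
    ∀ r : ℕ, 1 ≤ r → Negative.blockProb 3 (criticalProbI 3) ((r + 1) / 2) ≤
      (bondPercolation (zdGraph 3) (criticalProbI 3)).real
          (openCrossing
            (Set.Icc (![0, -(4 * (r : ℤ)), -(4 * (r : ℤ))] : Site 3) ![4 * (r : ℤ), 5 * (r : ℤ) - 1, 5 * (r : ℤ) - 1])
            {x : Site 3 | x 0 = 0 ∧ 0 ≤ x 1 ∧ x 1 < (r : ℤ) ∧ 0 ≤ x 2 ∧ x 2 < (r : ℤ)}
            {y : Site 3 | y ∈ Set.Icc (![0, -(4 * (r : ℤ)), -(4 * (r : ℤ))] : Site 3)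
                ![4 * (r : ℤ), 5 * (r : ℤ) - 1, 5 * (r : ℤ) - 1] ∧
              (y 0 = 4 * (r : ℤ) ∨ y 1 = -(4 * (r : ℤ)) ∨ y 1 = 5 * (r : ℤ) - 1 ∨
                y 2 = -(4 * (r : ℤ)) ∨ y 2 = 5 * (r : ℤ) - 1)})ᶜ :=
  _root_.Summit.CriticalPhenomena.PercolationContinuityZ3.Theorems.SubpolynomialBlocking.stub_enclosureOfBlocking

/-! ### Name-keyed aliases of the stub statements (hypotheses of the composition) -/
namespace Registered

/-- Alias of `ShieldCover` keyed by the registered stub name. -/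
abbrev stub_shieldCover : Prop := ShieldCover
/-- Alias of `HarrisShields` keyed by the registered stub name. -/
abbrev stub_harrisShields : Prop := HarrisShields
/-- Alias of `WallPatchEnclosureSubpoly` keyed by the registered stub name. -/
abbrev stub_wallPatchEnclosure : Prop := WallPatchEnclosureSubpoly
/-- Alias of `EnclosureOfBlocking` keyed by the registered stub name. -/
abbrev stub_enclosureOfBlocking : Prop := EnclosureOfBlocking

end Registered

/-! ### Readbacks: the expanded registered signatures ARE the local `Prop`s (definitional) -/

example : Registered.stub_shieldCover := stub_shieldCover
example : Registered.stub_harrisShields := stub_harrisShields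
example : Registered.stub_wallPatchEnclosure := stub_wallPatchEnclosure
example : Registered.stub_enclosureOfBlocking := stub_enclosureOfBlocking

/-! ## Proved plumbing -/

theorem h_nonneg (r : ℕ) : 0 ≤ h r := measureReal_nonneg

theorem h_le_one (r : ℕ) : h r ≤ 1 := measureReal_le_one

/-- The empty patch is trivially enclosed: `hsEvt 0 = univ`, so `h 0 = 1` and `C⁺` is about `r → ∞` only. -/
theorem hsEvt_zero : hsEvt 0 = Set.univ := by
  ext ω
  simp only [Set.mem_compl_iff, mem_openCrossing_iff, Set.mem_setOf_eq, Set.mem_univ, iff_true,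
    not_exists, not_and]
  intro x hx
  have h1 := hx.2.1
  have h2 := hx.2.2.1
  push_cast at h2
  omega

/-- `4 r(n) < n`, `r(n) ≥ 4`, `r(n) ≤ n` and the covering inequality `n + ⌊n/2⌋ < 10 r(n)` for `n ≥ 20`. -/
theorem cellScale_bounds {n : ℕ} (hn : 20 ≤ n) :
    4 ≤ cellScale n ∧ 4 * cellScale n < n ∧ cellScale n ≤ n ∧ n + n / 2 < 10 * cellScale n := by
  refine ⟨?_, ?_, Nat.div_le_self n 5, ?_⟩ <;> (unfold cellScale; omega)

/-- `r(n) → ∞`. -/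
theorem tendsto_cellScale : Tendsto cellScale atTop atTop := by
  refine tendsto_atTop_atTop.2 fun b => ⟨5 * b, fun n hn => ?_⟩
  unfold cellScale
  omega

/-! ## Composition, part 1: STUBS 1 + 2 ⟹ `seed n ≥ h(⌊n/5⌋)^100` -/

/-- Root trick + Harris: `h(⌊n/5⌋)^100 ≤ seed n` for `n ≥ 20` (the measure is supported on lattice configurations,
`real_mono_of_forall_subset_edgeSet`, so the deterministic STUB 1 transfers to probabilities). -/
theorem pow_h_le_seed (hcov : ShieldCover) (hhar : HarrisShields) {n : ℕ} (hn : 20 ≤ n) :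
    h (cellScale n) ^ 100 ≤ seed n := by
  obtain ⟨hr4, hr, -, hcover⟩ := cellScale_bounds hn
  refine (hhar (cellScale n)).trans ?_
  exact DCT16.real_mono_of_forall_subset_edgeSet (zdGraph 3) (criticalProbI 3)
    fun ω hω hmem => hcov n (cellScale n) (by omega) hr hcover ω hω fun c => Set.mem_iInter.1 hmem c

/-! ## Composition, part 2: + STUB 3 ⟹ seed sub-polynomial ⟹ the crux -/

/-- **`C⁺` ⟹ `SeedSubpoly 2`** (given the front end): with `r = ⌊n/5⌋ → ∞`,
`n^{-s} ≤ r^{-s} = (r^{-s/100})^100 ≤ h(r)^100 ≤ seed n` eventually. -/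
theorem seedSubpoly_of (hcov : ShieldCover) (hhar : HarrisShields) (hwall : WallPatchEnclosureSubpoly) :
    ∀ s : ℝ, 0 < s → ∀ᶠ n : ℕ in atTop, (n : ℝ) ^ (-s) ≤ seed n := by
  intro s hs
  have hw : ∀ᶠ r : ℕ in atTop, (r : ℝ) ^ (-(s / 100)) ≤ h r := hwall (s / 100) (by positivity)
  have hev : ∀ᶠ n : ℕ in atTop, ((cellScale n : ℕ) : ℝ) ^ (-(s / 100)) ≤ h (cellScale n) :=
    tendsto_cellScale.eventually hw
  filter_upwards [hev, eventually_ge_atTop 20] with n hn h20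
  obtain ⟨hr4, -, hrn, -⟩ := cellScale_bounds h20
  have hr0 : (0 : ℝ) < (cellScale n : ℝ) := by exact_mod_cast (lt_of_lt_of_le (by norm_num) hr4)
  have hrn' : ((cellScale n : ℕ) : ℝ) ≤ (n : ℝ) := by exact_mod_cast hrn
  have hpow_nonneg : 0 ≤ ((cellScale n : ℕ) : ℝ) ^ (-(s / 100)) := Real.rpow_nonneg hr0.le _
  have hsplit : ((cellScale n : ℕ) : ℝ) ^ (-s) = (((cellScale n : ℕ) : ℝ) ^ (-(s / 100))) ^ (100 : ℕ) := by
    rw [← Real.rpow_natCast, ← Real.rpow_mul hr0.le]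
    congr 1
    push_cast
    ring
  calc (n : ℝ) ^ (-s)
      ≤ ((cellScale n : ℕ) : ℝ) ^ (-s) :=
        Real.rpow_le_rpow_of_nonpos hr0 hrn' (by linarith)
    _ = (((cellScale n : ℕ) : ℝ) ^ (-(s / 100))) ^ (100 : ℕ) := hsplit
    _ ≤ h (cellScale n) ^ 100 := pow_le_pow_left₀ hpow_nonneg hn 100
    _ ≤ seed n := pow_h_le_seed hcov hhar h20

/-- The seed event of this file IS the `k = 2` event of the landed `stub_cruxIffSeedSubpoly` (definitional readback). -/
theorem seed_eq (n : ℕ) :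
    seed n = (bondPercolation (zdGraph 3) (criticalProbI 3)).real
      (openCrossing (Set.Icc (0 : Site 3) ![(n : ℤ), (n : ℤ) + (n / 2 : ℕ), (n : ℤ) + (n / 2 : ℕ)])
        {x | x ∈ Set.Icc (0 : Site 3) ![(n : ℤ), (n : ℤ) + (n / 2 : ℕ), (n : ℤ) + (n / 2 : ℕ)] ∧ x 0 = 0}
        {y | y ∈ Set.Icc (0 : Site 3) ![(n : ℤ), (n : ℤ) + (n / 2 : ℕ), (n : ℤ) + (n / 2 : ℕ)] ∧
          y 0 = (n : ℤ)})ᶜ :=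
  rfl

/-- **`C⁺` ⟹ crux** (given the front end), concluded as the disprover's readback `Negative.SubpolynomialBlockingAt 3 p_c`
(= the crux by `Negative.crux_iff`, `Iff.rfl`), through the landed certified equivalence `stub_cruxIffSeedSubpoly 2`. -/
theorem subpolynomialBlockingAt_of (hcov : ShieldCover) (hhar : HarrisShields)
    (hwall : WallPatchEnclosureSubpoly) : Negative.SubpolynomialBlockingAt 3 (criticalProbI 3) := by
  refine Negative.crux_iff.1 ((stub_cruxIffSeedSubpoly 2 le_rfl).2 ?_)
  intro s hs
  simpa only [seed_eq] using seedSubpoly_of hcov hhar hwall s hs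

/-! ## Composition, part 3: STUB 4 ⟹ (crux ⟹ `C⁺`), hence crux ⟺ `C⁺` -/

/-- `⌈r/2⌉ → ∞`. -/
theorem tendsto_half : Tendsto (fun r : ℕ => (r + 1) / 2) atTop atTop := by
  refine tendsto_atTop_atTop.2 fun b => ⟨2 * b, fun n hn => ?_⟩
  omega

/-- **crux ⟹ `C⁺`** (given STUB 4): `h r ≥ u_{⌈r/2⌉} ≥ ⌈r/2⌉^{-s} ≥ r^{-s}` eventually. -/
theorem wallPatch_of_crux (hnec : EnclosureOfBlocking) (hcrux : Negative.SubpolynomialBlockingAt 3 (criticalProbI 3)) :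
    WallPatchEnclosureSubpoly := by
  intro s hs
  have hu : ∀ᶠ m : ℕ in atTop, (m : ℝ) ^ (-s) ≤ Negative.blockProb 3 (criticalProbI 3) m :=
    (Negative.subpolynomialBlockingAt_iff 3 (criticalProbI 3)).1 hcrux s hs
  have hev : ∀ᶠ r : ℕ in atTop,
      (((r + 1) / 2 : ℕ) : ℝ) ^ (-s) ≤ Negative.blockProb 3 (criticalProbI 3) ((r + 1) / 2) :=
    tendsto_half.eventually hu
  filter_upwards [hev, eventually_ge_atTop 1] with r hr h1
  have hm1 : 1 ≤ (r + 1) / 2 := by omega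
  have hm0 : (0 : ℝ) < (((r + 1) / 2 : ℕ) : ℝ) := by exact_mod_cast hm1
  have hmr : (((r + 1) / 2 : ℕ) : ℝ) ≤ (r : ℝ) := by exact_mod_cast (show (r + 1) / 2 ≤ r by omega)
  calc (r : ℝ) ^ (-s) ≤ (((r + 1) / 2 : ℕ) : ℝ) ^ (-s) := Real.rpow_le_rpow_of_nonpos hm0 hmr (by linarith)
    _ ≤ Negative.blockProb 3 (criticalProbI 3) ((r + 1) / 2) := hr
    _ ≤ h r := hnec r h1

/-- **crux ⟺ `C⁺`** modulo the three provable-now stubs 1, 2, 4 (the line's equivalence claim, kernel-checked once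
they land): `WallPatchEnclosureSubpoly` is an exact relocation of the crux to the wall, not a strengthening. -/
theorem crux_iff_wallPatch (hcov : ShieldCover) (hhar : HarrisShields) (hnec : EnclosureOfBlocking) :
    Summit.CriticalPhenomena.PercolationContinuityZ3.Theses.PercNonProliferation.SubpolynomialBlocking ↔
      WallPatchEnclosureSubpoly :=
  ⟨fun hc => wallPatch_of_crux hnec (Negative.crux_iff.1 hc),
    fun hw => Negative.crux_iff.2 (subpolynomialBlockingAt_of hcov hhar hw)⟩

/-! ## The composition, by name -/

/-- **`SubpolynomialBlocking_of`**: the one OPEN registered stub (stub 3, `C⁺`) implies the crux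
`Summit.CriticalPhenomena.PercolationContinuityZ3.Theses.PercNonProliferation.SubpolynomialBlocking`
(kernel-checked; stubs 1, 2 landed and discharged by import; no `sorry` outside stub 3; stub 4 is the necessity
direction and is not an input). Lead c6 (2026-08-16): hypotheses reduced to the open stub only, so that
`ledger skeleton check` sees exactly the declared stubs. -/
theorem SubpolynomialBlocking_of (h3 : Registered.stub_wallPatchEnclosure) :
    Summit.CriticalPhenomena.PercolationContinuityZ3.Theses.PercNonProliferation.SubpolynomialBlocking :=
  Negative.crux_iff.2 (subpolynomialBlockingAt_of stub_shieldCover stub_harrisShields h3)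

/-- Wiring check: the one registered open stub feeds `SubpolynomialBlocking_of` as stated (stubs 1, 2 are LANDED
and discharged by import: `stub_shieldCover` p97113, `stub_harrisShields` p96555). -/
example : Summit.CriticalPhenomena.PercolationContinuityZ3.Theses.PercNonProliferation.SubpolynomialBlocking :=
  SubpolynomialBlocking_of stub_wallPatchEnclosure

/-- Wiring check of the necessity stub: with stubs 1, 2, 4 the crux and `C⁺` are equivalent. -/
example : Summit.CriticalPhenomena.PercolationContinuityZ3.Theses.PercNonProliferation.SubpolynomialBlocking ↔
    WallPatchEnclosureSubpoly :=
  crux_iff_wallPatch stub_shieldCover stub_harrisShields stub_enclosureOfBlocking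

/-! ## Readback against the landed Negative lane (examples, so `SubpolynomialBlocking_of` stays the only
named theorem concluding the crux) -/

/-- §2 honoured: the `(3, p)`-crux is FALSE for every `p > p_c(ℤ³)` (landed). Stubs 1, 2, 4 hold for every `p`, so
`C⁺` at such `p` is false too; the `p ≤ p_c` input belongs to STUB 3. -/
example (p : unitInterval) (hp : criticalProb (zdGraph 3) (0 : Site 3) < p) :
    ¬ Negative.SubpolynomialBlockingAt 3 p :=
  Negative.not_subpolynomialBlockingAt_three_of_criticalProb_lt p hp

/-- §6 honoured: the uniform-in-`s` strengthening of the crux is refuted (landed); `C⁺` keeps `∀ s, ∀ᶠ r`. -/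
example : ¬ ∃ N : ℕ, ∀ s : ℝ, 0 < s → ∀ n : ℕ, N ≤ n →
    (n : ℝ) ^ (-s) ≤ Negative.blockProb 3 (criticalProbI 3) n :=
  Negative.not_uniform_in_s

/-! ## Landed certificate (p115776): the equivalence and the floor, unconditionally -/

/-- crux ⟺ `C⁺`, kernel-checked in the tree (no hypotheses). -/
example : Summit.CriticalPhenomena.PercolationContinuityZ3.Theses.PercNonProliferation.SubpolynomialBlocking ↔
    WallPatchEnclosureSubpoly :=
  stub_cruxIffWallPatch

/-- The floor of the open stub: `∀ ε > 0`, eventually `exp(-ε r²) ≤ h(r)` (landed). -/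
example : ∀ ε : ℝ, 0 < ε → ∀ᶠ r : ℕ in atTop, Real.exp (-(ε * (r : ℝ) ^ 2)) ≤ h r :=
  wallPatchEnclosure_floor

/-- The named fact behind "BGN for fixed `r`" is in tree (unproved, cited only; no stub leans on it). -/
example : Prop := BarskyGrimmettNewman1991_Z3

end Summit.CriticalPhenomena.PercolationContinuityZ3.Cruxes.SubpolynomialBlocking.RootTrickWallPatch

end
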